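import Summits.BirchSwinnertonDyer.Rank1Residual.X11a.LambdaNorm
import Summits.BirchSwinnertonDyer.Rank1Residual.X11a.LambdaEndpoint
import HarnessLib

/-!
# Class X11a, surjective leaf: the Emerton–Pollack–Weston endpoint in the `normLam` currency
# (cell `b2b-bsdres`, unit `b2b-bsdres-x11a`, gen 15)

HONEST FRAMING (run/shared/lean/b2b/bsd-rank1-residual/, verbatim in every file): the goal of the
cell is to DELETE the COMBINATION-SHAPED residual classes of the Birch–Swinnerton-Dyer formula for
ALL analytic-rank `≤ 1` elliptic curves over `ℚ` — "full BSD formula for every rank `≤ 1` curve in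
class `C`" assembled STRICTLY from published theorems — so that the rank-`≤ 1` remainder becomes
exactly the CONSTRUCTION-SHAPED classes, which are TYPED (missing-input `Prop`s), NOT attempted.
This is not "finishing BSD". Research route; NO CLAIM BEYOND STATED CLASSES. Theorems only (no
definition, no named fact).

Purpose. The X11a chain (HOME/b2b-bsdres-x11a/X11A-CHAIN.md; lit audit PASS as a candidate,
HOME/b2b-bsdres-lit/g14/X11A-AUDIT.md) ends with Emerton–Pollack–Weston's Thm. 5.1.3 conclusion AT
`f_E`: "`μ^alg(f_E) = μ^an(f_E) = 0` and `λ^alg(f_E) = λ^an(f_E)`", where EPW's `λ` is "the smallest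
degree in which the power series has a unit coefficient" (Def. 4.4.6) — the tree's `normLam`
(`Literature/NumberTheory/EllipticCurves/IwasawaLambdaNorm.lean`, p203960), the currency shared with
the higher-weight member of the Hida family (`𝒪`-coefficients; `IsCycPAdicLFunctionWeightK`,
p204078). Gen 13's typed endpoint `X11a.InvariantsMatchAt W p` speaks eisenstein-p1's `ℤ_p`-only
`X1.MuLambda.mu / lam`. This file is the dictionary between the two at the Kato pairs `(gK, fE)` of
`X11a.InvariantsAt` (`ι(T^e gK) = ϖ·L_p`, `char_Λ X = (fE)`):

* `normLam_eq_of_iota_eq` / `normLam_eq_of_iota_X_mul_eq`: EPW's ANALYTIC `λ` at `f_E` read on THE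
  Mazur–Tate–Teitelbaum function `L`: `normLam L = normLam gK` (non-split, `ι gK = ϖ L`) and
  `normLam L = normLam gK + 1` (split, `ι(T·gK) = ϖ L`; the trivial zero) — scale invariance
  (`ϖ ≠ 0`) and transport along `ι : Λ ↪ ℚ_p⟦T⟧`;
* `invariantsMatchAt_of_invariantsAt_normLam`: "`HasUnitContent gK ∧ HasUnitContent fE ∧
  normLam gK = normLam fE` at every Kato pair" ⇒ `InvariantsMatchAt W p` (hence Mazur's main
  conjecture and `BSD(E,p)` on the leaf, `bsdp_of_invariantsAt_normLam`); and the converse;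
* `lambdaPartAt_of_invariantsAt_normLam_le`: "`… ∧ normLam gK ≤ normLam fE`" ⇒ `LambdaPartAt W p`;
* WITH the certificate `MuAnZeroAt W p` (⇒ both unit contents, gen 14 [L4]) the endpoint is just
  "`normLam gK = normLam fE` at every Kato pair" (`invariantsMatchAt_iff_invariantsAt_normLam_of_muAnZeroAt`,
  `bsdp_of_muAnZeroAt_of_invariantsAt_normLam_le`).

So the published supplier (EPW Thm. 1 + Thm. 5.1.3 with source the weight-`k` member `g`, and
X. Wan 2015 Thm. 4 at `g`), once typed against the GL₂ vocabulary, plugs in here with conclusion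
shape `InvariantsAt W p (fun gK fE => HasUnitContent gK ∧ HasUnitContent fE ∧ normLam gK = normLam fE)`.

References: [EmertonPollackWeston2006] Def. 4.4.6, Thm. 5.1.2, Thm. 5.1.3; [Washington1997] §7.1;
HOME/b2b-bsdres-x11a/GL2-VOCAB-SPEC.md §5.
-/

noncomputable section

open scoped Classical MatrixGroups ModularForm

open CongruenceSubgroup WeierstrassCurve Literature.NumberTheory.EllipticCurves
  Literature.NumberTheory.EllipticCurves.ModularForms
  Literature.NumberTheory.EllipticCurves.Rank1Residual
  Literature.NumberTheory.EllipticCurves.Rank1Residual.Typed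
  Literature.NumberTheory.EllipticCurves.Wuthrich2014
  Literature.NumberTheory.EllipticCurves.SteinWuthrich2013
  Literature.NumberTheory.EllipticCurves.GreenbergVatsal2000
  Summit.BirchSwinnertonDyer.Rank1Residual.X1.MuLambda
  Summit.BirchSwinnertonDyer.Rank1Residual.X11a.LambdaNorm

set_option autoImplicit false

namespace Summit.BirchSwinnertonDyer.Rank1Residual.X11a

/-! ### EPW's analytic `λ` at `f_E` read on the Mazur–Tate–Teitelbaum function -/

section Analytic

variable {p : ℕ} [Fact p.Prime]

/-- **Non-split shape**: if `ι g = c · L` in `ℚ_p⟦T⟧` with `c ≠ 0`, then `λ(L) = λ(g)` (scale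
invariance and transport of `normLam`). At a Kato pair this reads: EPW's `λ^an(f_E) = normLam gK`
(their `L_p^an(f_E)` is a non-zero constant multiple of THE Mazur–Tate–Teitelbaum function `L`).
[cite: EmertonPollackWeston2006, Def. 4.4.6 and the remark following it] -/
theorem normLam_eq_of_iota_eq {g : IwasawaAlgebra p} {c : ℚ_[p]} {L : PowerSeries ℚ_[p]}
    (hc : c ≠ 0) (h : iwasawaToPowerSeries p g = PowerSeries.C c * L) :
    normLam L = normLam g := by
  rw [← normLam_iwasawaToPowerSeries g, h, normLam_C_mul (norm_ne_zero_iff.mpr hc)]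

/-- **Split shape**: if `ι(T · g) = c · L` with `c ≠ 0` and `g` has unit content, then
`λ(L) = λ(g) + 1` (the trivial-zero factor `T`). [cite: EmertonPollackWeston2006, Def. 4.4.6 and Ex. 5.3.1] -/
theorem normLam_eq_of_iota_X_mul_eq {g : IwasawaAlgebra p} {c : ℚ_[p]} {L : PowerSeries ℚ_[p]}
    (hc : c ≠ 0) (h : iwasawaToPowerSeries p (PowerSeries.X * g) = PowerSeries.C c * L)
    (hg : HasUnitContent g) : normLam L = normLam g + 1 := by
  have h0 : ∃ n, ‖PowerSeries.coeff n g‖ ≠ 0 := by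
    obtain ⟨n, hn⟩ := (hasUnitContent_iff_exists_norm_eq_one g).mp hg
    exact ⟨n, by rw [hn]; exact one_ne_zero⟩
  rw [← normLam_C_mul (norm_ne_zero_iff.mpr hc) L, ← h, normLam_iwasawaToPowerSeries,
    normLam_X_mul (hasMaxCoeff_of_exists_norm_eq_one
      ((hasUnitContent_iff_exists_norm_eq_one g).mp hg)) h0]

/-- `HasMaxCoeff` for THE Mazur–Tate–Teitelbaum function at a Kato pair with unit-content `g`
(`ι(T^e g) = c·L`, `c ≠ 0`), `e ∈ {0, 1}` packaged as `X ^ e`. [folklore] -/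
theorem hasMaxCoeff_of_iota_X_pow_mul_eq {g : IwasawaAlgebra p} {c : ℚ_[p]} {L : PowerSeries ℚ_[p]}
    (e : ℕ) (hc : c ≠ 0) (h : iwasawaToPowerSeries p (PowerSeries.X ^ e * g) = PowerSeries.C c * L)
    (hg : HasUnitContent g) : HasMaxCoeff L := by
  rw [← hasMaxCoeff_C_mul_iff (norm_ne_zero_iff.mpr hc) L, ← h,
    hasMaxCoeff_map_iff _ (fun x => by simp) _]
  exact hasMaxCoeff_X_pow_mul (hasMaxCoeff_of_exists_norm_eq_one
    ((hasUnitContent_iff_exists_norm_eq_one g).mp hg)) e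

end Analytic

/-! ### The endpoint in the `normLam` currency -/

section Endpoint

variable (W : WeierstrassCurve ℚ) [W.IsElliptic] [W.IsGloballyMinimal] (p : ℕ) [Fact p.Prime]

/-- **EPW's invariants at `f_E` in `normLam` currency give gen 13's `InvariantsMatchAt`**:
unit content of `gK` and `fE` is `μ(gK) = μ(fE) = 0` (`mu_eq_zero_of_hasUnitContent`) and for
unit-content series `lam = normLam` (`lam_eq_normLam`). [cite: EmertonPollackWeston2006, Def. 4.4.6 and Thm. 5.1.3] -/
theorem invariantsMatchAt_of_invariantsAt_normLam
    (h : InvariantsAt W p fun g fE => HasUnitContent g ∧ HasUnitContent fE ∧ normLam g = normLam fE) :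
    InvariantsMatchAt W p :=
  (invariantsMatchAt_iff W p).mpr (h.mono fun g fE h' => by
    obtain ⟨hg, hfE, hn⟩ := h'
    exact ⟨by rw [mu_eq_zero_of_hasUnitContent hg, mu_eq_zero_of_hasUnitContent hfE],
      by rw [lam_eq_normLam hg, lam_eq_normLam hfE, hn]⟩)

/-- **The λ-part from `normLam gK ≤ normLam fE`** (with both unit contents). [cite: EmertonPollackWeston2006, Def. 4.4.6] -/
theorem lambdaPartAt_of_invariantsAt_normLam_le
    (h : InvariantsAt W p fun g fE => HasUnitContent g ∧ HasUnitContent fE ∧ normLam g ≤ normLam fE) :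
    LambdaPartAt W p :=
  h.mono fun g fE h' => by
    obtain ⟨hg, hfE, hn⟩ := h'
    rw [lam_eq_normLam hg, lam_eq_normLam hfE]
    exact hn

/-- Conversely, WITH the certificate `μ^an(E,p) = 0` (and Kato, `p ≥ 5`, surjective image — which
give both unit contents, gen 14 [L4]), `InvariantsMatchAt` is "`normLam gK = normLam fE` at every
Kato pair". [cite: EmertonPollackWeston2006, Def. 4.4.6 and Thm. 5.1.3] -/
theorem invariantsMatchAt_iff_invariantsAt_normLam_of_muAnZeroAt
    (hKato : kato_charIdeal_dvd_multiplicative_of_surjective)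
    (hp : 5 ≤ p) (hmult : W.HasMultiplicativeReductionAtPrime p)
    (hsurj : W.HasSurjectiveModNGaloisRep p) (hμ : MuAnZeroAt W p) :
    InvariantsMatchAt W p ↔
      InvariantsAt W p fun g fE => HasUnitContent g ∧ HasUnitContent fE ∧ normLam g = normLam fE := by
  have huc := invariantsAt_hasUnitContent_generator_of_muAnZeroAt W p hKato hp hmult hsurj hμ
  constructor
  · intro h
    exact (((invariantsMatchAt_iff W p).mp h).and huc).mono fun g fE h' => by
      obtain ⟨⟨-, hlam⟩, hg, hfE, -, -⟩ := h'
      refine ⟨hg, hfE, ?_⟩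
      rw [← lam_eq_normLam hg, ← lam_eq_normLam hfE, hlam]
  · exact invariantsMatchAt_of_invariantsAt_normLam W p

/-- WITH the certificate, the λ-part is "`normLam gK ≤ normLam fE` at every Kato pair".
[cite: EmertonPollackWeston2006, Def. 4.4.6] -/
theorem lambdaPartAt_iff_invariantsAt_normLam_le_of_muAnZeroAt
    (hKato : kato_charIdeal_dvd_multiplicative_of_surjective)
    (hp : 5 ≤ p) (hmult : W.HasMultiplicativeReductionAtPrime p)
    (hsurj : W.HasSurjectiveModNGaloisRep p) (hμ : MuAnZeroAt W p) :
    LambdaPartAt W p ↔ InvariantsAt W p fun g fE => normLam g ≤ normLam fE := by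
  have huc := invariantsAt_hasUnitContent_generator_of_muAnZeroAt W p hKato hp hmult hsurj hμ
  constructor
  · intro h
    exact ((show InvariantsAt W p fun g fE => lam g ≤ lam fE from h).and huc).mono fun g fE h' => by
      obtain ⟨hlam, hg, hfE, -, -⟩ := h'
      rwa [lam_eq_normLam hg, lam_eq_normLam hfE] at hlam
  · intro h
    exact lambdaPartAt_of_invariantsAt_normLam_le W p ((h.and huc).mono fun g fE h' => by
      obtain ⟨hn, hg, hfE, -, -⟩ := h'
      exact ⟨hg, hfE, hn⟩)

/-- **`BSD(E,p)` on the surjective leaf from EPW's invariants in `normLam` currency** (composition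
with gen 13's `bsdp_of_invariantsMatchAt`: Kato A32 + Greenberg–Stevens + `𝓛 ≠ 0` + Stein–Wuthrich
Thm. 6.1 + GZK + modularity; `r_an = 0`). This is the socket for the typed EPW Thm. 1 + Thm. 5.1.3
(source: a good-ordinary higher-weight member of `H(E[p])`) ∘ Wan 2015 Thm. 4.
[cite: EmertonPollackWeston2006, Thm. 5.1.2 and Thm. 5.1.3] [cite: SteinWuthrich2013, Thm. 6.1 (p. 20)] -/
theorem bsdp_of_invariantsAt_normLam
    (hKato : kato_charIdeal_dvd_multiplicative_of_surjective)
    (hJs : thm61_splitMultiplicative) (hJn : thm61_nonsplitMultiplicative)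
    (hHs : exists_isSplitMultCanonical) (hHn : exists_isMultCanonical)
    (hGZK : rank_eq_analyticRank_of_analyticRank_le_one) (hmod : hasEntireLFunction_rat)
    (hpar : nonempty_modularParametrizationData)
    (hGS : greenberg_stevens (W := W) (p := p))
    (hp : 5 ≤ p) (hmult : W.HasMultiplicativeReductionAtPrime p)
    (hsurj : W.HasSurjectiveModNGaloisRep p) (hr : W.analyticRank = 0)
    (h : InvariantsAt W p fun g fE => HasUnitContent g ∧ HasUnitContent fE ∧ normLam g = normLam fE) :
    BSDp W p :=
  bsdp_of_invariantsMatchAt hKato hJs hJn hHs hHn hGZK hmod hpar W p hGS hp hmult hsurj hr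
    (invariantsMatchAt_of_invariantsAt_normLam W p h)

/-- **`BSD(E,p)` from the certificate and `normLam gK ≤ normLam fE`** (the weakest form the chain
must deliver; e.g. from `normLam gK = normLam fE`). [cite: EmertonPollackWeston2006, Thm. 5.1.2 and Thm. 5.1.3]
[cite: SteinWuthrich2013, Thm. 6.1 (p. 20)] -/
theorem bsdp_of_muAnZeroAt_of_invariantsAt_normLam_le
    (hKato : kato_charIdeal_dvd_multiplicative_of_surjective)
    (hJs : thm61_splitMultiplicative) (hJn : thm61_nonsplitMultiplicative)
    (hHs : exists_isSplitMultCanonical) (hHn : exists_isMultCanonical)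
    (hGZK : rank_eq_analyticRank_of_analyticRank_le_one) (hmod : hasEntireLFunction_rat)
    (hpar : nonempty_modularParametrizationData)
    (hGS : greenberg_stevens (W := W) (p := p))
    (hp : 5 ≤ p) (hmult : W.HasMultiplicativeReductionAtPrime p)
    (hsurj : W.HasSurjectiveModNGaloisRep p) (hr : W.analyticRank = 0) (hμ : MuAnZeroAt W p)
    (h : InvariantsAt W p fun g fE => normLam g ≤ normLam fE) : BSDp W p :=
  bsdp_of_muAnZeroAt_of_lambdaPart W p hKato hJs hJn hHs hHn hGZK hmod hpar hGS hp hmult hsurj hr hμ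
    ((lambdaPartAt_iff_invariantsAt_normLam_le_of_muAnZeroAt W p hKato hp hmult hsurj hμ).mpr h)

end Endpoint

end Summit.BirchSwinnertonDyer.Rank1Residual.X11a

end
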